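import Literature.AlgebraicGeometry.HodgeTheory.CotangentSheafValueAtOrigin
import Literature.AlgebraicGeometry.Modules.FiniteFrameProjections
import Literature.AlgebraicGeometry.Motives.PushforwardStructureSheaf
import Mathlib.LinearAlgebra.Dimension.OrzechProperty
import HarnessLib

/-!
# Global `1`-forms on an abelian variety are determined by their value at the origin; `[n]^* ω = n · ω`

Layer `Literature/AlgebraicGeometry/Motives`, namespace `Literature.AlgebraicGeometry.Motives.AbelianVariety`.  THEOREMS ONLY
(no definition, no instance, no notation, no named fact, no `sorry`).  Sequel of ★ `HodgeTheory/CotangentSheafValueAtOrigin`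
(the value `ev : Γ(V, Ω¹_{A/K}) → 𝔪_e/𝔪_e²` of a `1`-form at the origin of an abelian variety `A/K` on an affine `V ∋ e`, and the
chain rule `(u^*ω)(e) = T_e^*(u)(ω(e))`) and of ★ `Modules/FiniteFrameProjections` (the frame `Ω¹_A ≅ 𝒪_A^{dim A}` of
[MumfordAV1970] §4 (iii) as module maps `π_a`, `σ_a`).

MATHEMATICS ([MumfordAV1970] §4 (iii)–(iv), pp. 42–43; [GortzWedhorn2023] Rem. 27.18).  Since `Ω¹_A ≅ 𝒪_A^g` and
`Γ(A, 𝒪_A) = K` (`A` proper, geometrically integral), a global `1`-form is `∑ c_a σ_a` with CONSTANT coefficients, and the values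
`σ_a(e)` form a basis of `T_e^*(A) = 𝔪_e/𝔪_e²` (they span: every cotangent vector is `[b − b(e)] = (db)(e)` on a small affine open;
`dim = g`); hence **a global `1`-form is determined by its value at `e`** (§4; over a field every global form is translation
invariant).  For the endomorphism `[n] = n • 𝟙_A`, the global form `[n]^*ω − n·ω` has value `T_e^*([n])(ω(e)) − n·ω(e) = 0`
(tree `cotangentMap_zsmul_id_eq_smul`: `T_e^*([n]) = n`), so **`[n]^* ω = n · ω`** (§5) — Mumford's «`(f + g)^*ω = f^*ω + g^*ω` for
invariant `ω`» at `f = g = …`; the shape consumed on Čech cochains is `[n]^*(ω|_V) = n · ω|_{[n]⁻¹V}` (`comap_zsmul_one_app_map`).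

* §1 plumbing: `sum_app_apply`, `app_map_apply` (naturality of `φ.app`), `eq_sum_smul_app_one_of_frame` (`x = ∑ (π_a x) • σ_a(1)`),
  `map_app_one`;
* §2 `exists_constToPresheaf_app_top_eq` (`Γ(A, 𝒪_A) = K`, tree `isIso_appTop_of_geometricallyIntegral`), `map_constToPresheaf_app`,
  `evalOrigin_germ_constToPresheaf`;
* §3 `linearIndependent_valueAtOrigin_frame_of_shrinking` — the `ev(σ_a(1))` are linearly independent (hence a basis) in `𝔪_e/𝔪_e²`;
* §4 **`globalOneForm_eq_zero_of_valueAtOrigin_map_eq_zero`** — `ev(ω|_V) = 0 ⇒ ω = 0` for a global `1`-form `ω`;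
* §5 **`comap_zsmul_one_app_top`** — `[n]^* ω = n • ω` in `Γ(A, Ω¹)`; **`comap_zsmul_one_app_map`** — the cochain form on every open `V`;
  `exists_affineOpen_origin_mem_le`.

Companion: `Motives/AbelianVarietyGlobalOneFormsMulN` (B-p03 (g21)) states §§3–5 for an arbitrary endomorphism `u` with
`T_e^*(u) = c` modulo the value maps as hypotheses; this file is the unconditional instance over ★ `CotangentSheafValueAtOrigin`.
Cell hodgecm-mathlib (D-0151), F-11 α1 / J4-(iv) brick (iv-2b)(β) (the `d[n] = n` input of relation 1 of the GAP-2 backbone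
`Morphisms/CechModuleH2ScalingVanishing`); HC_CM is proved only modulo the 7 printed citations until rung 0 closes — nothing here
bears on it.

## References
* [MumfordAV1970] D. Mumford, *Abelian Varieties* (1970), §4 (iii)–(iv) (pp. 42–43).
* [GortzWedhorn2023] U. Görtz, T. Wedhorn, *Algebraic Geometry II* (2023), Rem. 27.18 (1), proof of Prop. 27.187.
* [GortzWedhorn2020] U. Görtz, T. Wedhorn, *Algebraic Geometry I*, 2nd ed. (2020), (6.3.1), (6.4), Prop. 6.7, Prop. 12.66.
* [Hartshorne1977] R. Hartshorne, *Algebraic Geometry* (1977), II §5 (p. 109).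
* [StacksProject] The Stacks Project, Tag 01ED.
-/

noncomputable section

open CategoryTheory AlgebraicGeometry Opposite TopologicalSpace

namespace Literature.AlgebraicGeometry.Motives.AbelianVariety

open Literature.AlgebraicGeometry.HodgeTheory Literature.AlgebraicGeometry.Motives
open Literature.AlgebraicGeometry.Modules

variable {K : Type} [Field K] (A : AbelianVariety K)

/-! ## §1 Plumbing: sums of module maps on sections; frames as coefficient decompositions -/

section Plumbing

variable {X : Scheme.{0}} {M N : X.Modules}

/-- `(∑ φ_b).app U x = ∑ (φ_b.app U x)`. [cite: StacksProject, Tag 01ED (Cohomology, Section 20.9)] -/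
theorem sum_app_apply {ι : Type} (s : Finset ι) (φ : ι → (M ⟶ N)) (U : X.Opens) (x : Γ(M, U)) :
    (∑ b ∈ s, φ b).app U x = ∑ b ∈ s, (φ b).app U x := by
  classical
  induction s using Finset.induction_on with
  | empty => rw [Finset.sum_empty, Finset.sum_empty, Scheme.Modules.Hom.zero_app]; rfl
  | insert b s hb ih =>
    rw [Finset.sum_insert hb, Finset.sum_insert hb, Scheme.Modules.Hom.add_app, ← ih]; rfl

/-- Naturality of `φ.app` with respect to restriction. [cite: StacksProject, Tag 01ED (Cohomology, Section 20.9)] -/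
theorem app_map_apply (φ : M ⟶ N) {U V : X.Opens} (i : V ⟶ U) (x : Γ(M, U)) :
    φ.app V (M.presheaf.map i.op x) = N.presheaf.map i.op (φ.app U x) := by
  have h := ConcreteCategory.congr_hom (φ.mapPresheaf.naturality i.op) x
  rw [ConcreteCategory.comp_apply, ConcreteCategory.comp_apply, Scheme.Modules.mapPresheaf_app,
    Scheme.Modules.mapPresheaf_app] at h
  exact h

/-- A finite frame `∑_b π_b ≫ σ_b = 𝟙_M` of module maps through `𝒪_X` decomposes every section:
`x = ∑_b (π_b x) • σ_b(1)`. [cite: Hartshorne1977, II §5 (p. 109)] -/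
theorem eq_sum_smul_app_one_of_frame {ι : Type} [Fintype ι] (π : ι → (M ⟶ unitModule X))
    (σ : ι → (unitModule X ⟶ M)) (hsum : ∑ b, π b ≫ σ b = 𝟙 M) (U : X.Opens) (x : Γ(M, U)) :
    x = ∑ b, (show Γ(X, U) from (π b).app U x) • (σ b).app U (show Γ(unitModule X, U) from (1 : Γ(X, U))) := by
  have h := sum_app_apply Finset.univ (fun b => π b ≫ σ b) U x
  rw [hsum, Scheme.Modules.Hom.id_app] at h
  change x = _ at h
  conv_lhs => rw [h]
  refine Finset.sum_congr rfl fun b _ => ?_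
  rw [Scheme.Modules.Hom.comp_app]
  change (σ b).app U ((π b).app U x) = _
  rw [← Scheme.Modules.Hom.app_smul]
  congr 1
  exact (mul_one (show Γ(X, U) from (π b).app U x)).symm

/-- `σ(1)|_V = σ(1|_V) = σ(1)` on the smaller open: the basis section restricts to the basis section.
[cite: Hartshorne1977, II §5 (p. 109)] -/
theorem map_app_one (σ : unitModule X ⟶ M) {U V : X.Opens} (i : V ⟶ U) :
    M.presheaf.map i.op (σ.app U (show Γ(unitModule X, U) from (1 : Γ(X, U)))) =
      σ.app V (show Γ(unitModule X, V) from (1 : Γ(X, V))) := by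
  rw [← app_map_apply]
  congr 1
  exact map_one (X.presheaf.map i.op).hom

end Plumbing

/-! ## §2 Global functions on an abelian variety are constants -/

section Constants

variable {A}

/-- **`Γ(A, 𝒪_A) = K`**: every global function on an abelian variety is a constant (`A` is proper and geometrically integral
over `K`; tree `isIso_appTop_of_geometricallyIntegral`, [GortzWedhorn2020] Prop. 12.66 / [GortzWedhorn2023] Cor. 24.63).
[cite: GortzWedhorn2020, Prop. 12.66 (p. 350)] -/
theorem exists_constToPresheaf_app_top_eq (r : Γ(A.X.left, ⊤)) :
    ∃ c : K, (constToPresheaf A.X).app (op ⊤) c = r := by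
  haveI := A.isProper
  haveI := A.geometricallyIntegral
  haveI := isIso_appTop_of_geometricallyIntegral A.X.hom
  have hsurj : Function.Surjective A.X.hom.appTop := (ConcreteCategory.bijective_of_isIso A.X.hom.appTop).2
  obtain ⟨t, ht⟩ := hsurj r
  refine ⟨(Scheme.ΓSpecIso (.of K)).hom t, ?_⟩
  change A.X.left.presheaf.map (homOfLE le_top).op (A.X.hom.appTop ((Scheme.ΓSpecIso (.of K)).inv
    ((Scheme.ΓSpecIso (.of K)).hom t))) = r
  rw [← CommRingCat.comp_apply (Scheme.ΓSpecIso (.of K)).hom, Iso.hom_inv_id, CommRingCat.id_apply, ht]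
  have h1 : (homOfLE (le_top : (⊤ : A.X.left.Opens) ≤ ⊤)) = 𝟙 _ := Subsingleton.elim _ _
  rw [h1, op_id, CategoryTheory.Functor.map_id]
  rfl

/-- Constants restrict to constants. [cite: GortzWedhorn2020, Prop. 12.66 (p. 350)] -/
theorem map_constToPresheaf_app {U V : A.X.left.Opens} (i : V ⟶ U) (c : K) :
    A.X.left.presheaf.map i.op ((constToPresheaf A.X).app (op U) c) = (constToPresheaf A.X).app (op V) c := by
  have h := ConcreteCategory.congr_hom ((constToPresheaf A.X).naturality i.op) c
  rw [ConcreteCategory.comp_apply, ConcreteCategory.comp_apply] at h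
  exact h.symm

/-- The value at the origin of a constant is the constant. [cite: GortzWedhorn2020, (6.4) and Proposition 6.7 (p. 152)] -/
theorem evalOrigin_germ_constToPresheaf {V : A.X.left.Opens} (heV : origin A ∈ V) (c : K) :
    evalOrigin A (A.X.left.presheaf.germ V (origin A) heV ((constToPresheaf A.X).app (op V) c)) = c := by
  rw [germ_constToPresheaf, evalOrigin_algebraMap]

end Constants

/-! ## §3 The values at the origin of a global frame of `Ω¹_A` form a basis of `𝔪_e/𝔪_e²` -/

section Frame

variable {A} {V : A.X.left.Opens}

/-- **The values at `e` of the basis differentials of a frame `Ω¹_A ≅ 𝒪_A^{dim A}` are linearly independent in `𝔪_e/𝔪_e²`**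
(they span — every cotangent vector is `[a − a(e)] = ev(da)` on a small affine open, and `da` is a combination of the basis
differentials — and their number is `dim A = dim_K 𝔪_e/𝔪_e²`, tree `finrank_cotangent`). [cite: MumfordAV1970, §4 (iii) (p. 42)]
[cite: GortzWedhorn2020, (6.3.1), (6.4) and Proposition 6.7 (p. 152)] -/
theorem linearIndependent_valueAtOrigin_frame_of_shrinking (hV : IsAffineOpen V) (heV : origin A ∈ V)
    {ev : Γ(cotangentSheaf A.X, V) →+ Cotangent A}
    (hev : ∀ (r : Γ(A.X.left, V)) (ω : Γ(cotangentSheaf A.X, V)),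
      ev (r • ω) = evalOrigin A (A.X.left.presheaf.germ V (origin A) heV r) • ev ω)
    (hevd : ∀ a : Γ(A.X.left, V),
      ev (dSection A.X V a) = Cotangent.mk A (dOrigin (A.X.left.presheaf.germ V (origin A) heV a)))
    {ι : Type} [Fintype ι] (π : ι → (cotangentSheaf A.X ⟶ unitModule A.X.left))
    (σ : ι → (unitModule A.X.left ⟶ cotangentSheaf A.X)) (hsum : ∑ b, π b ≫ σ b = 𝟙 _)
    (hcard : Fintype.card ι = A.dim) :
    LinearIndependent K (fun b => ev ((σ b).app V (show Γ(unitModule A.X.left, V) from (1 : Γ(A.X.left, V))))) := by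
  refine linearIndependent_of_top_le_span_of_card_eq_finrank (fun m _ => ?_) (by rw [hcard, finrank_cotangent])
  -- `m = [a − a(e)] = ev_W (da)` on an affine `W ≤ V` containing `e`
  obtain ⟨W, hW, heW, hWV, a, ha⟩ := exists_affineOpen_mk_dOrigin_germ_eq heV m
  obtain ⟨evW, hevW, hevWd⟩ := exists_valueAtOrigin hW heW
  rw [← ha, ← hevWd, eq_sum_smul_app_one_of_frame π σ hsum W (dSection A.X W a), map_sum]
  refine Submodule.sum_mem _ fun b _ => ?_
  rw [hevW, ← map_app_one (σ b) (homOfLE hWV), valueAtOrigin_map hV heV heW hWV hev hevd hevW hevWd]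
  exact Submodule.smul_mem _ _ (Submodule.subset_span ⟨b, rfl⟩)

end Frame

/-! ## §4 A global `1`-form vanishing at the origin is zero -/

section Determined

variable {A} {V : A.X.left.Opens}

/-- **Global `1`-forms on an abelian variety are determined by their value at the origin**: a global section `ω` of
`Ω¹_{A/K}` whose value at `e` vanishes is `0` (write `ω = ∑ c_b σ_b` in a global frame — the coefficients are global
functions, hence constants `c_b ∈ K` — and read `0 = ev(ω) = ∑ c_b ev(σ_b)` against the linear independence of the `ev(σ_b)`;
[MumfordAV1970] §4 (iii): the global `1`-forms are exactly the invariant ones, `≅ T_e^*`).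
[cite: MumfordAV1970, §4 (iii) (p. 42)] [cite: GortzWedhorn2020, (6.3.1), (6.4) and Proposition 6.7 (p. 152)] -/
theorem globalOneForm_eq_zero_of_valueAtOrigin_map_eq_zero (hV : IsAffineOpen V) (heV : origin A ∈ V)
    {ev : Γ(cotangentSheaf A.X, V) →+ Cotangent A}
    (hev : ∀ (r : Γ(A.X.left, V)) (ω : Γ(cotangentSheaf A.X, V)),
      ev (r • ω) = evalOrigin A (A.X.left.presheaf.germ V (origin A) heV r) • ev ω)
    (hevd : ∀ a : Γ(A.X.left, V),
      ev (dSection A.X V a) = Cotangent.mk A (dOrigin (A.X.left.presheaf.germ V (origin A) heV a)))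
    (ω : Γ(cotangentSheaf A.X, ⊤))
    (h : ev ((cotangentSheaf A.X).presheaf.map (homOfLE le_top).op ω) = 0) : ω = 0 := by
  obtain ⟨_, π, σ, hsum, -, -, -⟩ := exists_frameMaps_cotangentSheaf A
  have hLI := linearIndependent_valueAtOrigin_frame_of_shrinking hV heV hev hevd π σ hsum (Fintype.card_fin A.dim)
  -- coefficients are constants
  have hc : ∀ b, ∃ c : K, (constToPresheaf A.X).app (op ⊤) c = (show Γ(A.X.left, ⊤) from (π b).app ⊤ ω) :=
    fun b => exists_constToPresheaf_app_top_eq _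
  choose c hc using hc
  -- `ev(ω|_V) = ∑ c_b • ev(σ_b(1))`
  have hdec := eq_sum_smul_app_one_of_frame π σ hsum ⊤ ω
  have hres : (cotangentSheaf A.X).presheaf.map (homOfLE (le_top : V ≤ ⊤)).op ω =
      ∑ b, (constToPresheaf A.X).app (op V) (c b) •
        (σ b).app V (show Γ(unitModule A.X.left, V) from (1 : Γ(A.X.left, V))) := by
    conv_lhs => rw [hdec]
    rw [map_sum]
    refine Finset.sum_congr rfl fun b _ => ?_
    rw [Scheme.Modules.map_smul, map_app_one, ← hc b, map_constToPresheaf_app]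
  rw [hres, map_sum] at h
  simp_rw [hev, evalOrigin_germ_constToPresheaf] at h
  have hc0 : ∀ b, c b = 0 := Fintype.linearIndependent_iff.mp hLI c h
  rw [hdec]
  refine Finset.sum_eq_zero fun b _ => ?_
  have : (show Γ(A.X.left, ⊤) from (π b).app ⊤ ω) = 0 := by
    rw [← hc b, hc0 b]
    exact map_zero ((constToPresheaf A.X).app (op ⊤)).hom
  rw [this, zero_smul]

end Determined

/-! ## §5 `[n]^* ω = n · ω` for every global `1`-form -/

section MulN

variable {A}

/-- An affine open neighbourhood of the origin inside a given open neighbourhood (affine opens form a basis).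
[cite: GortzWedhorn2020, (6.4) and Proposition 6.7 (p. 152)] -/
theorem exists_affineOpen_origin_mem_le (U : A.X.left.Opens) (heU : origin A ∈ U) :
    ∃ V : A.X.left.Opens, IsAffineOpen V ∧ origin A ∈ V ∧ V ≤ U := by
  obtain ⟨V, hV, heV, hVU⟩ := (Opens.isBasis_iff_nbhd.mp (Scheme.isBasis_affineOpens A.X.left)) heU
  exact ⟨V, hV, heV, hVU⟩

/-- **`[n]^* ω = n · ω` for every global `1`-form `ω` on an abelian variety** ([MumfordAV1970] §4 (iv): for homomorphisms
`f, g` and an invariant form `ω`, `(f + g)^*ω = f^*ω + g^*ω`; over a field every global `1`-form is invariant).  Proof: the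
global form `[n]^*ω − n·ω` has value `T_e^*([n])(ω(e)) − n·ω(e) = 0` at the origin (chain rule ★ `valueAtOrigin_comap` and
`T_e^*([n]) = n`, tree `cotangentMap_zsmul_id_eq_smul`), hence vanishes (`globalOneForm_eq_zero_of_valueAtOrigin_eq_zero`).
Here `[n] = n • 𝟙 A` and `[n]^* = cotangentSheaf.comap` (`Γ([n]_* Ω¹, ⊤) = Γ(Ω¹, [n]⁻¹⊤) = Γ(Ω¹, ⊤)` definitionally).
[cite: MumfordAV1970, §4 (iv) (p. 42–43)] [cite: GortzWedhorn2023, proof of Prop. 27.187 (p. 675)] -/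
theorem comap_zsmul_one_app_top (n : ℤ) (ω : Γ(cotangentSheaf A.X, ⊤)) :
    (show Γ(cotangentSheaf A.X, ⊤) from (cotangentSheaf.comap (n • 𝟙 A).hom.hom.hom).app ⊤ ω) = n • ω := by
  set u : A ⟶ A := n • 𝟙 A with hu
  -- affine `V ∋ e`, and affine `V' ∋ e` inside `V ∩ u⁻¹V`
  obtain ⟨V, hV, heV, -⟩ := exists_affineOpen_origin_mem_le (A := A) ⊤ trivial
  have heuV : origin A ∈ (Hom.toSchemeHom u) ⁻¹ᵁ V :=
    show (Hom.toSchemeHom u).base (origin A) ∈ V by rwa [toSchemeHom_origin]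
  obtain ⟨V', hV', heV', hV'le⟩ :=
    exists_affineOpen_origin_mem_le (A := A) (V ⊓ (Hom.toSchemeHom u) ⁻¹ᵁ V) ⟨heV, heuV⟩
  obtain ⟨ev, hev, hevd⟩ := exists_valueAtOrigin hV heV
  obtain ⟨ev', hev', hev'd⟩ := exists_valueAtOrigin hV' heV'
  -- the value at `e` of `u^*ω`, read on `V'`, is `T_e^*(u) (ω(e))`
  have h1 : ev' ((cotangentSheaf A.X).presheaf.map (homOfLE (le_top : V' ≤ ⊤)).op
      (show Γ(cotangentSheaf A.X, ⊤) from (cotangentSheaf.comap u.hom.hom.hom).app ⊤ ω)) =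
      cotangentMap A u (ev ((cotangentSheaf A.X).presheaf.map (homOfLE (le_top : V ≤ ⊤)).op ω)) := by
    have hnat : (cotangentSheaf A.X).presheaf.map (homOfLE (le_top : V' ≤ ⊤)).op
        (show Γ(cotangentSheaf A.X, ⊤) from (cotangentSheaf.comap u.hom.hom.hom).app ⊤ ω) =
        (cotangentSheaf A.X).presheaf.map (homOfLE (hV'le.trans inf_le_right)).op
          ((cotangentSheaf.comap u.hom.hom.hom).app V
            ((cotangentSheaf A.X).presheaf.map (homOfLE (le_top : V ≤ ⊤)).op ω)) := by
      rw [app_map_apply, Scheme.Modules.pushforward_obj_presheaf_map]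
      change _ = ((cotangentSheaf A.X).presheaf.map _ ≫ (cotangentSheaf A.X).presheaf.map _) _
      rw [← Functor.map_comp]
      rfl
    rw [hnat]
    exact valueAtOrigin_comap u hV heV heV' (hV'le.trans inf_le_right) hev hevd hev' hev'd _
  -- the value at `e` of `ω`, read on `V'`, is `ω(e)` read on `V`
  have h2 : ev' ((cotangentSheaf A.X).presheaf.map (homOfLE (le_top : V' ≤ ⊤)).op ω) =
      ev ((cotangentSheaf A.X).presheaf.map (homOfLE (le_top : V ≤ ⊤)).op ω) := by
    have hcomp : (cotangentSheaf A.X).presheaf.map (homOfLE (le_top : V' ≤ ⊤)).op ω =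
        (cotangentSheaf A.X).presheaf.map (homOfLE (hV'le.trans inf_le_left)).op
          ((cotangentSheaf A.X).presheaf.map (homOfLE (le_top : V ≤ ⊤)).op ω) := by
      change _ = ((cotangentSheaf A.X).presheaf.map _ ≫ (cotangentSheaf A.X).presheaf.map _) _
      rw [← Functor.map_comp]
      rfl
    rw [hcomp, valueAtOrigin_map hV heV heV' (hV'le.trans inf_le_left) hev hevd hev' hev'd]
  -- `T_e^*([n]) = n`, so the global form `u^*ω − n ω` vanishes at `e`, hence everywhere
  rw [← sub_eq_zero]
  refine globalOneForm_eq_zero_of_valueAtOrigin_map_eq_zero hV' heV' hev' hev'd _ ?_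
  rw [map_sub, map_zsmul, map_sub, map_zsmul, h1, h2, hu, cotangentMap_zsmul_id_eq_smul,
    LinearMap.smul_apply, LinearMap.id_apply, Int.cast_smul_eq_zsmul, sub_self]

/-- **Cochain form of `[n]^* ω = n · ω`**: for every open `V`, the pull-back along `[n] = n • 𝟙 A` of the restriction
`ω|_V` of a GLOBAL `1`-form is `n · ω|_{[n]⁻¹V}` (the shape consumed on Čech cochains; `Γ([n]_*Ω¹, V) = Γ(Ω¹, [n]⁻¹V)`).
[cite: MumfordAV1970, §4 (iv) (p. 42–43)] [cite: GortzWedhorn2023, proof of Prop. 27.187 (p. 675)] -/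
theorem comap_zsmul_one_app_map (n : ℤ) (ω : Γ(cotangentSheaf A.X, ⊤)) (V : A.X.left.Opens) :
    (cotangentSheaf.comap (n • 𝟙 A).hom.hom.hom).app V
        ((cotangentSheaf A.X).presheaf.map (homOfLE (le_top : V ≤ ⊤)).op ω) =
      n • (cotangentSheaf A.X).presheaf.map
        (homOfLE (le_top : (Hom.toSchemeHom (n • 𝟙 A)) ⁻¹ᵁ V ≤ ⊤)).op ω := by
  rw [app_map_apply, Scheme.Modules.pushforward_obj_presheaf_map]
  have h := comap_zsmul_one_app_top n ω
  change (cotangentSheaf.comap (n • 𝟙 A).hom.hom.hom).app ⊤ ω = n • ω at h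
  change (cotangentSheaf A.X).presheaf.map _ ((cotangentSheaf.comap (n • 𝟙 A).hom.hom.hom).app ⊤ ω) = _
  rw [h]
  exact map_zsmul ((cotangentSheaf A.X).presheaf.map _).hom n ω

end MulN

end Literature.AlgebraicGeometry.Motives.AbelianVariety

end
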